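import Summits.Ventures.CertifiedManyBodySolver.Transport.ChainWindowParticleHole
import HarnessLib

/-!
# Ventures/CertifiedManyBodySolver — Transport/ChainWindowParticleHoleRows.lean

Speedrun cell sr-mbsolver — LIT team (lit-1 gen-7), LEAD r118 (c) "STAGE 3", part B3 (2 of 2): THE ROWS OF THE ENT / `tl_marginal`
NODE UNDER THE BIPARTITE PARTICLE–HOLE MAP `U = phOp n` (half filling).
HONEST FRAMING: first certified bounds; not a superconductivity verdict; every number certified or labelled float.

For the window `{-1, …, n+1}` and `U = phOp n = ⨂_x uPH(ε_x)` (part 1): (i) the local-translation-invariance row survives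
`ρ ↦ UρUᴴ` on SECTOR-BLOCK-DIAGONAL `ρ` — the two sub-window sign patterns differ by a global flip `ε ↦ −ε`, i.e. by the fermion
parity `Π = ⨂F`, which commutes with `U` and acts trivially on the (parity-even) marginal; (ii) the entropy row survives
(product unitary); (iii) `U n_avg Uᴴ = 2 − n_avg`, so the density row `Re tr(n_avg ρ) = ν` goes to `2 − ν` and survives iff
`ν = 1` (HALF FILLING — the only filling at which op-08's files carry `particle_hole_bipartite`); (iv) `U h_bond(x,x+1) Uᴴ =
h_bond(x,x+1) + (U/2)(2 − n_x − n_{x+1})` (the hopping term is invariant because `ε_x ε_{x+1} = −1`, the pair term shifts by the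
site densities), hence `Re tr(h_avg · UρUᴴ) = Re tr(h_avg ρ)` for every `ρ` satisfying the LTI row, trace one and the density
row at `ν = 1` (every site then has density `1`: `trace_nAt_eq_of_lti`); (v) the interplay with the other two generators:
`W U Wᴴ = (−1)^{n+3} ⨂_x uPH(ε_n ε_x)` (`W = reflectPV n`), so `W (UρUᴴ) Wᴴ = UρUᴴ` for `W`-invariant sector-block-diagonal `ρ`
(again via `Π`), and `s · conj(s) = 1` for the spin-flip phase `s = (−1)^{n+3}`. No sorry, no axiom, no new definition.
[cite: KullEtAl2024, §II.B, §VI.B] [cite: EsslerEtAl2005, §2.2.4, §12.3.4] [cite: LiebWu1968, eq. (4)]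
[cite: FawziFawziScalet2024Entropy, Theorem 4.1] [cite: BratteliRobinsonII1997, §6.2.1]
-/

noncomputable section

open Matrix Complex
open scoped ComplexOrder BigOperators
open Literature.Probability.LatticeModels
open Literature.MathematicalPhysics.QuantumLattice
open Literature.MathematicalPhysics.QuantumLattice.HubbardWave0
open Literature.MathematicalPhysics.QuantumLattice.JordanWigner
open Literature.InformationTheory.Entropy (vonNeumannEntropy)

namespace Summit.Ventures.CertifiedManyBodySolver.Transport

/-! ### §1 Generic conjugation facts -/

section Generic

variable {Y : Type} [Fintype Y] [DecidableEq Y] {q : ℕ}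

/-- **A site permutation relabels a product operator**: `P (⨂_y u_y) Pᴴ = ⨂_y u_{e⁻¹ y}`. [cite: BratteliRobinsonII1997, §6.2.1] -/
theorem permOp_conj_productOp (e : Y ≃ Y) (u : Y → Matrix (Fin q) (Fin q) ℂ) :
    permOp e * productOp u * (permOp e)ᴴ = productOp (fun y => u (e.symm y)) := by
  rw [permOp_mul_mul_conjTranspose]
  ext σ τ
  rw [reindexOp_apply, productOp_apply, productOp_apply]
  exact Fintype.prod_equiv e _ _ (fun x => by rw [Equiv.symm_apply_apply])

/-- `tr(H · UρUᴴ) = tr(UᴴHU · ρ)`. [folklore] -/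
theorem trace_mul_conj (U H ρ : Op Y q) : (H * (U * ρ * Uᴴ)).trace = ((Uᴴ * H * U) * ρ).trace := by
  rw [show H * (U * ρ * Uᴴ) = (H * U * ρ) * Uᴴ by simp only [Matrix.mul_assoc], Matrix.trace_mul_cycle,
    show Uᴴ * (H * U) * ρ = (Uᴴ * H * U) * ρ by simp only [Matrix.mul_assoc]]

/-- Inserting `WᴴW = 1`: `W (UρUᴴ) Wᴴ = (WUWᴴ)(WρWᴴ)(WUWᴴ)ᴴ`. [folklore] -/
theorem conj_conj_of_unitary {W : Op Y q} (hW : Wᴴ * W = 1) (U ρ : Op Y q) :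
    W * (U * ρ * Uᴴ) * Wᴴ = (W * U * Wᴴ) * (W * ρ * Wᴴ) * (W * U * Wᴴ)ᴴ := by
  have h : ∀ X : Op Y q, Wᴴ * (W * X) = X := fun X => by rw [← Matrix.mul_assoc, hW, Matrix.one_mul]
  rw [Matrix.conjTranspose_mul, Matrix.conjTranspose_mul, Matrix.conjTranspose_conjTranspose]
  simp only [Matrix.mul_assoc, h]

omit [Fintype Y] [DecidableEq Y] in
/-- `s · conj(s) = 1` for `s = (−1)^m`. [folklore] -/
theorem neg_one_pow_mul_star (m : ℕ) : ((-1 : ℂ) ^ m) * star ((-1 : ℂ) ^ m) = 1 := by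
  rw [star_pow, star_neg, star_one, ← mul_pow, neg_one_mul, neg_neg, one_pow]

omit [DecidableEq Y] in
/-- `Uᴴ = (−1)^{#sites} U` for `U = ⨂_y uPH(ε_y)` (each factor is real antisymmetric). [folklore] -/
theorem phProd_conjTranspose {ε : Y → ℂ} (hε : ∀ y, ε y = 1 ∨ ε y = -1) :
    (productOp (fun y => uPH (ε y)))ᴴ = ((-1 : ℂ) ^ Fintype.card Y) • productOp (fun y => uPH (ε y)) := by
  have h : ∀ y, (uPH (ε y))ᴴ = (-1 : ℂ) • uPH (ε y) := fun y => by rw [uPH_conjTranspose (hε y), neg_one_smul]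
  rw [productOp_conjTranspose]
  simp_rw [h]
  rw [productOp_smul, Finset.prod_const, Finset.card_univ]

/-- Hence `Uᴴ H U = U H Uᴴ`. [folklore] -/
theorem phProd_conjTranspose_conj {ε : Y → ℂ} (hε : ∀ y, ε y = 1 ∨ ε y = -1) (H : Op Y 4) :
    (productOp (fun y => uPH (ε y)))ᴴ * H * productOp (fun y => uPH (ε y)) =
      productOp (fun y => uPH (ε y)) * H * (productOp (fun y => uPH (ε y)))ᴴ := by
  rw [phProd_conjTranspose hε, Matrix.smul_mul, Matrix.smul_mul, Matrix.mul_smul]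

end Generic

/-! ### §2 The bond density under `⨂ uPH(ε)`: hopping invariant, pair term shifted by the site densities -/

section Bond

variable {Λ : Finset (Site 1)}

/-- **`U h_bond(x,y) Uᴴ = h_bond(x,y) + (U/2)(2 − n_x − n_y)`** for `y = x + 1` and opposite signs `ε_y = −ε_x`.
[cite: EsslerEtAl2005, §2.2.4] [cite: LiebWu1968, eq. (4)] -/
theorem phProd_conj_toSpin_tlmBond (t U : ℝ) {ε : PolySite Λ → ℂ} (hε : ∀ z, ε z = 1 ∨ ε z = -1) {x y : Site 1}
    (hx : x ∈ Λ) (hy : y ∈ Λ) (h : y 0 = x 0 + 1) (hxy : ε (PolySite.pt y hy) = -ε (PolySite.pt x hx)) :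
    productOp (fun z => uPH (ε z)) * toSpin (tlmBond t U x y hx hy) * (productOp (fun z => uPH (ε z)))ᴴ =
      toSpin (tlmBond t U x y hx hy) + ((U / 2 : ℝ) : ℂ) •
        ((2 : ℂ) • 1 - ∑ σ : Fin 2, toSpin (nAt x hx σ) - ∑ σ : Fin 2, toSpin (nAt y hy σ)) := by
  have hu : ∀ z, (uPH (ε z))ᴴ * uPH (ε z) = 1 := fun z => uPH_conjTranspose_mul_self (hε z)
  have hu' : ∀ z, uPH (ε z) * (uPH (ε z))ᴴ = 1 := fun z => uPH_mul_conjTranspose_self (hε z)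
  have hεε : ε (PolySite.pt x hx) * ε (PolySite.pt x hx) = 1 := by rcases hε (PolySite.pt x hx) with h1 | h1 <;> simp [h1]
  have hop : ∀ σ : Fin 2, productOp (fun z => uPH (ε z)) *
      (onSite (PolySite.pt x hx) (siteCreation σ * siteParity) * onSite (PolySite.pt y hy) (siteAnnihilation σ) +
        onSite (PolySite.pt x hx) (siteParity * siteAnnihilation σ) * onSite (PolySite.pt y hy) (siteCreation σ)) *
      (productOp (fun z => uPH (ε z)))ᴴ =
      onSite (PolySite.pt x hx) (siteCreation σ * siteParity) * onSite (PolySite.pt y hy) (siteAnnihilation σ) +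
        onSite (PolySite.pt x hx) (siteParity * siteAnnihilation σ) * onSite (PolySite.pt y hy) (siteCreation σ) := by
    intro σ
    rw [conj_add, productOp_conj_mul hu, productOp_conj_mul hu, productOp_conj_onSite hu', productOp_conj_onSite hu',
      productOp_conj_onSite hu', productOp_conj_onSite hu', uPH_conj_siteCreation_mul_siteParity (hε _),
      uPH_conj_siteAnnihilation (hε _), uPH_conj_siteParity_mul_siteAnnihilation (hε _), uPH_conj_siteCreation (hε _), hxy,
      onSite_smul', onSite_smul', onSite_smul', onSite_smul', Matrix.smul_mul, Matrix.mul_smul, Matrix.smul_mul, Matrix.mul_smul,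
      smul_smul, smul_smul, neg_mul_neg, hεε, one_smul, one_smul, add_comm]
  rw [toSpin_tlmBond_of_succ t U hx hy h, conj_add, conj_smul, conj_smul, conj_sum, conj_add, productOp_conj_onSite hu',
    productOp_conj_onSite hu', uPH_conj_siteDouble (hε _), uPH_conj_siteDouble (hε _),
    Finset.sum_congr rfl fun σ _ => hop σ, add_assoc, ← smul_add]
  congr 2
  rw [Fin.sum_univ_two, Fin.sum_univ_two, toSpin_numberOp, toSpin_numberOp, toSpin_numberOp, toSpin_numberOp, onSite_add',
    onSite_sub', onSite_sub', onSite_one', onSite_add', onSite_sub', onSite_sub', onSite_one', two_smul]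
  abel

end Bond

/-! ### §3 The rows of `EntTLMChainNode` under `phOp n` (window `{-1, …, n+1}`, half filling) -/

section Rows

variable (n : ℕ)

/-- `Uᴴ H U = U H Uᴴ` for `U = phOp n`. [folklore] -/
theorem phOp_conjTranspose_conj (H : Op (PolySite (chainWindow (-1) ((n : ℤ) + 1))) 4) :
    (phOp n)ᴴ * H * phOp n = phOp n * H * (phOp n)ᴴ :=
  phProd_conjTranspose_conj (fun _ => phSign_cases _) H

/-- The shifted sub-window embedding FLIPS every bipartite sign. [folklore] -/
theorem phSign_affEmb (x : PolySite (chainWindow (-1) (n : ℤ))) :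
    phSign (ofLex (((PolySite.affEmb 1 (unitVec 0) (chainWindow (-1) (n : ℤ))).trans
      (PolySite.incl (affShiftSet_chainWindow_subset (-1) (n : ℤ)))) x).1 0) = -phSign (ofLex x.1 0) := by
  simp only [Function.Embedding.trans_apply, PolySite.coe_incl, PolySite.ofLex_coe_affEmb, affSite_apply, Units.val_one, one_mul,
    unitVec, Pi.single_eq_same]
  exact phSign_add_one _

/-- **The LTI row survives `phOp` on sector-block-diagonal `ρ`.** [cite: KullEtAl2024, §II.B eq. (locTIn)] -/
theorem phOp_ltiRow {ρ : Op (PolySite (chainWindow (-1) ((n : ℤ) + 1))) 4}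
    (hsec : ∀ σ : Fin 2, ∀ k k',
      (∑ x, if σ ∈ siteOcc (k x) then 1 else 0 : ℕ) ≠ (∑ x, if σ ∈ siteOcc (k' x) then 1 else 0 : ℕ) → ρ k k' = 0)
    (hLTI : spinPartialTrace ((PolySite.affEmb 1 (unitVec 0) (chainWindow (-1) (n : ℤ))).trans
        (PolySite.incl (affShiftSet_chainWindow_subset (-1) (n : ℤ)))) ρ =
      spinPartialTrace (PolySite.incl (chainWindow_mono_right (-1) (by omega : (n : ℤ) ≤ n + 1))) ρ) :
    spinPartialTrace ((PolySite.affEmb 1 (unitVec 0) (chainWindow (-1) (n : ℤ))).trans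
        (PolySite.incl (affShiftSet_chainWindow_subset (-1) (n : ℤ)))) (phOp n * ρ * (phOp n)ᴴ) =
      spinPartialTrace (PolySite.incl (chainWindow_mono_right (-1) (by omega : (n : ℤ) ≤ n + 1))) (phOp n * ρ * (phOp n)ᴴ) := by
  have hu : ∀ y : PolySite (chainWindow (-1) ((n : ℤ) + 1)), uPH (phSign (ofLex y.1 0)) ∈ Matrix.unitaryGroup (Fin 4) ℂ :=
    fun y => uPH_mem_unitaryGroup (phSign_cases _)
  have hF : ∀ _ : PolySite (chainWindow (-1) ((n : ℤ) + 1)), siteParity ∈ Matrix.unitaryGroup (Fin 4) ℂ := fun _ => by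
    rw [Matrix.mem_unitaryGroup_iff, Matrix.star_eq_conjTranspose, siteParity_eq]
    ext a b; fin_cases a <;> fin_cases b <;> simp [Matrix.mul_apply, Fin.sum_univ_four, Matrix.conjTranspose_apply]
  have h1 : (fun x : PolySite (chainWindow (-1) (n : ℤ)) => uPH (phSign (ofLex (((PolySite.affEmb 1 (unitVec 0)
      (chainWindow (-1) (n : ℤ))).trans (PolySite.incl (affShiftSet_chainWindow_subset (-1) (n : ℤ)))) x).1 0))) =
      fun x : PolySite (chainWindow (-1) (n : ℤ)) => uPH (-phSign (ofLex x.1 0)) := funext fun x => by rw [phSign_affEmb]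
  have h2 : (fun x : PolySite (chainWindow (-1) (n : ℤ)) => uPH (phSign (ofLex ((PolySite.incl
      (chainWindow_mono_right (-1) (by omega : (n : ℤ) ≤ n + 1))) x).1 0))) =
      fun x : PolySite (chainWindow (-1) (n : ℤ)) => uPH (phSign (ofLex x.1 0)) :=
    funext fun x => by rw [PolySite.coe_incl]
  have hPar := spinPartialTrace_productOp_conj (PolySite.incl (chainWindow_mono_right (-1) (by omega : (n : ℤ) ≤ n + 1)))
    (u := fun _ => siteParity) hF ρ
  rw [parity_conj_of_sectorRow hsec] at hPar
  rw [phOp, spinPartialTrace_productOp_conj _ hu ρ, spinPartialTrace_productOp_conj _ hu ρ, hLTI, h1, h2, phProd_neg,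
    parity_mul_phProd, mul_conj_eq, ← hPar]

/-- **The entropy row survives `phOp`.** [cite: FawziFawziScalet2024Entropy, Theorem 4.1] -/
theorem phOp_entropyRow {ρ : Op (PolySite (chainWindow (-1) ((n : ℤ) + 1))) 4} (hρ : ρ.PosSemidef)
    (hent : 0 ≤ vonNeumannEntropy ρ -
      vonNeumannEntropy (spinPartialTrace (PolySite.incl (chainWindow_mono_right (-1) (by omega : (n : ℤ) ≤ n + 1))) ρ)) :
    0 ≤ vonNeumannEntropy (phOp n * ρ * (phOp n)ᴴ) -
      vonNeumannEntropy (spinPartialTrace (PolySite.incl (chainWindow_mono_right (-1) (by omega : (n : ℤ) ≤ n + 1)))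
        (phOp n * ρ * (phOp n)ᴴ)) := by
  rw [phOp, entropy_sub_spinPartialTrace_productOp_conj _ (fun y => uPH_mem_unitaryGroup (phSign_cases _)) hρ.1]
  exact hent

/-- **`U n_avg Uᴴ = 2 − n_avg`.** [cite: EsslerEtAl2005, §2.2.4] -/
theorem phOp_conj_toSpin_tlmDensity : phOp n * toSpin (tlmDensity n) * (phOp n)ᴴ = (2 : ℂ) • 1 - toSpin (tlmDensity n) := by
  have hu' : ∀ y : PolySite (chainWindow (-1) ((n : ℤ) + 1)), uPH (phSign (ofLex y.1 0)) * (uPH (phSign (ofLex y.1 0)))ᴴ = 1 :=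
    fun y => uPH_mul_conjTranspose_self (phSign_cases _)
  have h : ∀ p : PolySite (chainWindow (-1) ((n : ℤ) + 1)),
      phOp n * toSpin (∑ σ : Fin 2, numberOp p σ) * (phOp n)ᴴ = (2 : ℂ) • 1 - toSpin (∑ σ : Fin 2, numberOp p σ) := by
    intro p
    rw [phOp, map_sum, conj_sum, Fin.sum_univ_two, Fin.sum_univ_two, toSpin_numberOp, toSpin_numberOp, productOp_conj_onSite hu',
      productOp_conj_onSite hu', uPH_conj_siteNumber (phSign_cases _), uPH_conj_siteNumber (phSign_cases _), onSite_sub',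
      onSite_sub', onSite_one', two_smul]
    abel
  have h3 : ((n + 3 : ℕ) : ℂ) ≠ 0 := Nat.cast_ne_zero.mpr (by omega)
  have hc : (((1 / ((n : ℝ) + 3) : ℝ)) : ℂ) * ((n + 3 : ℕ) : ℂ) = 1 := by
    rw [show (((1 / ((n : ℝ) + 3) : ℝ)) : ℂ) = (((n + 3 : ℕ) : ℂ))⁻¹ by push_cast; ring, inv_mul_cancel₀ h3]
  rw [tlmDensity, map_smul, map_sum, conj_smul, conj_sum]
  simp_rw [h]
  rw [Finset.sum_sub_distrib, Finset.sum_const, Finset.card_univ, card_polySite_chainWindow, smul_sub, ← Nat.cast_smul_eq_nsmul ℂ,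
    smul_smul, hc, one_smul]

/-- **The density row at half filling survives `phOp`** (`ν ↦ 2 − ν`, so `ν = 1` is needed and suffices). [cite: LiebWu1968, eq. (4)] -/
theorem phOp_densityRow {ρ : Op (PolySite (chainWindow (-1) ((n : ℤ) + 1))) 4} (htr : ρ.trace = 1)
    (hdens : ((toSpin (tlmDensity n) * ρ).trace).re = ((1 : ℚ) : ℝ)) :
    ((toSpin (tlmDensity n) * (phOp n * ρ * (phOp n)ᴴ)).trace).re = ((1 : ℚ) : ℝ) := by
  rw [Rat.cast_one] at hdens ⊢
  rw [trace_mul_conj, phOp_conjTranspose_conj, phOp_conj_toSpin_tlmDensity, Matrix.sub_mul, Matrix.trace_sub, Matrix.smul_mul,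
    Matrix.one_mul, Matrix.trace_smul, htr, Complex.sub_re, hdens, smul_eq_mul, mul_one]
  norm_num

/-- **Every site has the average density in an LTI window state**: `Σ_σ tr(n_{xσ} ρ) = tr(n_avg ρ)`. [cite: KullEtAl2024, §II.B eq. (locTIn)] -/
theorem trace_siteDensity_eq_of_lti {ρ : Op (PolySite (chainWindow (-1) ((n : ℤ) + 1))) 4}
    (hLTI : spinPartialTrace ((PolySite.affEmb 1 (unitVec 0) (chainWindow (-1) (n : ℤ))).trans
        (PolySite.incl (affShiftSet_chainWindow_subset (-1) (n : ℤ)))) ρ =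
      spinPartialTrace (PolySite.incl (chainWindow_mono_right (-1) (by omega : (n : ℤ) ≤ n + 1))) ρ)
    (x : Site 1) (hx : x ∈ chainWindow (-1) ((n : ℤ) + 1)) :
    ∑ σ : Fin 2, (toSpin (nAt x hx σ) * ρ).trace = (toSpin (tlmDensity n) * ρ).trace := by
  have hsite : ∀ (p : PolySite (chainWindow (-1) ((n : ℤ) + 1))) (σ : Fin 2),
      (toSpin (numberOp p σ) * ρ).trace = (toSpin (nAt (-unitVec 0) ((tlm_pair_subset n) tlm_neg_mem_pair) σ) * ρ).trace := by
    intro p σ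
    have hp := mem_chainWindow.1 (PolySite.ofLex_mem p)
    obtain ⟨c, hc, hpc⟩ : ∃ c : ℕ, c ≤ n + 2 ∧ ofLex p.1 0 = (c : ℤ) - 1 := ⟨(ofLex p.1 0 + 1).toNat, by omega, by omega⟩
    have e : p = PolySite.pt (tlmSite c) (tlmSite_mem hc) := polySite_eq_of_coord_eq (by rw [PolySite.ofLex_coe_pt, tlmSite, hpc])
    rw [e]
    exact trace_nAt_eq_of_lti n hc σ hLTI
  rw [trace_tlmDensity_eq_of_lti n hLTI]
  refine Finset.sum_congr rfl fun σ _ => ?_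
  exact (hsite (PolySite.pt x hx) σ).trans (hsite (PolySite.pt 0 _) σ).symm

/-- `ε_{x_{j+1}} = −ε_{x_j}` along the window. [folklore] -/
theorem phSign_tlmSite_succ (j : ℕ) (hj : j ≤ n + 2) (hj' : j + 1 ≤ n + 2) :
    (fun z : PolySite (chainWindow (-1) ((n : ℤ) + 1)) => phSign (ofLex z.1 0)) (PolySite.pt (tlmSite (j + 1)) (tlmSite_mem hj')) =
      -(fun z : PolySite (chainWindow (-1) ((n : ℤ) + 1)) => phSign (ofLex z.1 0)) (PolySite.pt (tlmSite j) (tlmSite_mem hj)) := by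
  simp only [PolySite.ofLex_coe_pt]
  rw [tlmSite_succ_apply, phSign_add_one]

/-- **`U h_avg Uᴴ = h_avg + (U/2)·(n+2)⁻¹ Σ_j (2 − n_{x_j} − n_{x_{j+1}})`.** [cite: EsslerEtAl2005, §2.2.4] [cite: KullEtAl2024, §II.B] -/
theorem phOp_conj_toSpin_tlmObjective (t U : ℝ) :
    phOp n * toSpin (tlmObjective t U n) * (phOp n)ᴴ = toSpin (tlmObjective t U n) +
      (((1 / ((n : ℝ) + 2) : ℝ)) : ℂ) • (((U / 2 : ℝ) : ℂ) • ∑ j : Fin (n + 2),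
        ((2 : ℂ) • 1 - ∑ σ : Fin 2, toSpin (nAt (tlmSite (j : ℕ)) (tlmSite_mem (by omega)) σ) -
          ∑ σ : Fin 2, toSpin (nAt (tlmSite ((j : ℕ) + 1)) (tlmSite_mem (by omega)) σ))) := by
  rw [phOp, tlmObjective, map_smul, map_sum, conj_smul, conj_sum, ← smul_add]
  congr 1
  rw [Finset.smul_sum, ← Finset.sum_add_distrib]
  refine Finset.sum_congr rfl fun j _ => ?_
  exact phProd_conj_toSpin_tlmBond t U (fun _ => phSign_cases _) _ _ (tlmSite_succ_apply j)
    (phSign_tlmSite_succ n j (by omega) (by omega))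

/-- **The objective is particle–hole invariant at half filling** (given the LTI row, trace one and density `1`).
[cite: LiebWu1968, eq. (4)] [cite: KullEtAl2024, §II.B] -/
theorem phOp_objective (t U : ℝ) {ρ : Op (PolySite (chainWindow (-1) ((n : ℤ) + 1))) 4} (htr : ρ.trace = 1)
    (hLTI : spinPartialTrace ((PolySite.affEmb 1 (unitVec 0) (chainWindow (-1) (n : ℤ))).trans
        (PolySite.incl (affShiftSet_chainWindow_subset (-1) (n : ℤ)))) ρ =
      spinPartialTrace (PolySite.incl (chainWindow_mono_right (-1) (by omega : (n : ℤ) ≤ n + 1))) ρ)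
    (hdens : ((toSpin (tlmDensity n) * ρ).trace).re = ((1 : ℚ) : ℝ)) :
    ((toSpin (tlmObjective t U n) * (phOp n * ρ * (phOp n)ᴴ)).trace).re = ((toSpin (tlmObjective t U n) * ρ).trace).re := by
  have hT : ((toSpin (tlmDensity n) * ρ).trace).re = 1 := by rw [hdens, Rat.cast_one]
  have hE : ∀ j : Fin (n + 2), (((2 : ℂ) • 1 - ∑ σ : Fin 2, toSpin (nAt (tlmSite (j : ℕ)) (tlmSite_mem (by omega)) σ) -
      ∑ σ : Fin 2, toSpin (nAt (tlmSite ((j : ℕ) + 1)) (tlmSite_mem (by omega)) σ)) * ρ).trace =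
      2 * (1 - (toSpin (tlmDensity n) * ρ).trace) := by
    intro j
    rw [Matrix.sub_mul, Matrix.sub_mul, Matrix.trace_sub, Matrix.trace_sub, Matrix.smul_mul, Matrix.one_mul, Matrix.trace_smul, htr,
      Finset.sum_mul, Finset.sum_mul, Matrix.trace_sum, Matrix.trace_sum, trace_siteDensity_eq_of_lti n hLTI,
      trace_siteDensity_eq_of_lti n hLTI, smul_eq_mul]
    ring
  rw [trace_mul_conj, phOp_conjTranspose_conj, phOp_conj_toSpin_tlmObjective, Matrix.add_mul, Matrix.trace_add, Complex.add_re,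
    Matrix.smul_mul, Matrix.smul_mul, Matrix.trace_smul, Matrix.trace_smul, Finset.sum_mul, Matrix.trace_sum]
  simp_rw [hE]
  rw [Finset.sum_const, Finset.card_univ, Fintype.card_fin, smul_eq_mul, smul_eq_mul, nsmul_eq_mul,
    show (((1 / ((n : ℝ) + 2) : ℝ)) : ℂ) * ((((U / 2 : ℝ)) : ℂ) * (((n + 2 : ℕ) : ℂ) * (2 * (1 - (toSpin (tlmDensity n) * ρ).trace)))) =
      (((1 / ((n : ℝ) + 2)) * (U / 2) * ((n : ℝ) + 2) * 2 : ℝ) : ℂ) * (1 - (toSpin (tlmDensity n) * ρ).trace) by push_cast; ring,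
    Complex.re_ofReal_mul, Complex.sub_re, Complex.one_re, hT, sub_self, mul_zero, add_zero]

/-! ### §4 Interplay with the reflection `W = reflectPV n` -/

/-- **`W U Wᴴ = (−1)^{n+3} ⨂_x uPH(ε_n ε_x)`** (`d u d = −F u`, `P` relabels `x ↦ n − x`, `ε_{n−x} = −ε_n ε_x`). [folklore] -/
theorem reflectPV_conj_phOp : reflectPV n * phOp n * (reflectPV n)ᴴ = ((-1 : ℂ) ^ (n + 3)) •
    productOp (fun y : PolySite (chainWindow (-1) ((n : ℤ) + 1)) => uPH (phSign n * phSign (ofLex y.1 0))) := by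
  have h : ∀ y : PolySite (chainWindow (-1) ((n : ℤ) + 1)),
      uDouble * uPH (phSign (ofLex y.1 0)) * uDouble = (-1 : ℂ) • uPH (-phSign (ofLex y.1 0)) := fun y => by
    rw [uDouble_mul_uPH_mul_uDouble, siteParity_mul_uPH, neg_one_smul]
  have hr : ∀ y : PolySite (chainWindow (-1) ((n : ℤ) + 1)),
      -phSign (ofLex ((chainReflect (-1) ((n : ℤ) + 1)) y).1 0) = phSign n * phSign (ofLex y.1 0) := fun y => by
    rw [chainReflect_apply_zero, show (-1 : ℤ) + ((n : ℤ) + 1) - ofLex y.1 0 = (n : ℤ) - ofLex y.1 0 by ring, phSign_sub, neg_neg]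
  rw [reflectPV, mul_conj_eq, dbl_conjTranspose, phOp, productOp_mul, productOp_mul]
  simp_rw [h]
  rw [productOp_smul, Finset.prod_const, Finset.card_univ, card_polySite_chainWindow, conj_smul, permOp_conj_productOp,
    chainReflect_symm]
  simp_rw [hr]

/-- **`W (UρUᴴ) Wᴴ = UρUᴴ` for `W`-invariant sector-block-diagonal `ρ`** (so `W`-invariance survives the particle–hole average).
[folklore] -/
theorem reflectPV_conj_phOp_conj {ρ : Op (PolySite (chainWindow (-1) ((n : ℤ) + 1))) 4}
    (hsec : ∀ σ : Fin 2, ∀ k k',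
      (∑ x, if σ ∈ siteOcc (k x) then 1 else 0 : ℕ) ≠ (∑ x, if σ ∈ siteOcc (k' x) then 1 else 0 : ℕ) → ρ k k' = 0)
    (hW : reflectPV n * ρ * (reflectPV n)ᴴ = ρ) :
    reflectPV n * (phOp n * ρ * (phOp n)ᴴ) * (reflectPV n)ᴴ = phOp n * ρ * (phOp n)ᴴ := by
  rw [conj_conj_of_unitary (reflectPV_conjTranspose_mul_self n), hW, reflectPV_conj_phOp, Matrix.conjTranspose_smul,
    Matrix.smul_mul, Matrix.smul_mul, Matrix.mul_smul, smul_smul, neg_one_pow_mul_star, one_smul]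
  rcases phSign_cases (n : ℤ) with h1 | h1
  · simp_rw [h1, one_mul]
    rfl
  · simp_rw [h1, neg_one_mul]
    rw [phProd_neg, mul_conj_eq, parity_conj_of_sectorRow (phProd_sectorRow _ hsec)]
    rfl

end Rows

end Summit.Ventures.CertifiedManyBodySolver.Transport
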